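import Literature.MathematicalPhysics.QuantumFieldTheory.Balaban1983to89.B9GradViaDivLettersAtPins
import Literature.MathematicalPhysics.QuantumFieldTheory.Balaban1983to89.B9CoReadingCoordsInputS
import Literature.MathematicalPhysics.QuantumFieldTheory.Balaban1983to89.B9Ineq344TowerChart
import Literature.MathematicalPhysics.QuantumFieldTheory.Balaban1983to89.B3Bound323ZeroTorus
import Literature.MathematicalPhysics.QuantumFieldTheory.Balaban1983to89.B3KernelConvolutionTorus
import Literature.MathematicalPhysics.QuantumFieldTheory.Balaban1983to89.B9PerturbationMajorantAlgebra

/-!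
# `Balaban1983to89.B9GradViaDivLettersAtPinsHolderPairs` — [B9] (3.3) p. 390 ∕ (3.40) p. 397 at node00-def-Y's letters: THE PAIR BOOKKEEPING FOR THE
# HÖLDER READING OF THE KINEMATIC LETTER `J_μ(U)` of `D_U = Σ_μ ∇*_{U,μ} ∘ J_μ(U)` — n06-d's flat input norms `bHS ∕ bHK` on a localized vector, the η-scale
# vs ξ-scale pair weights on charted torus sites, the value of `J_μλ` at two bonds of one direction, and the re-weighting of block-norm majorants by
# powers of the scale length (the companion `B9GradViaDivLettersAtPinsHolder` assembles the Hölder majorant)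

T. Bałaban, *Propagators for lattice gauge theories in a background field*, Commun. Math. Phys. **99** (1985) 389–434
[`Balaban1985BackgroundPropagators`, "B9"]; [4] = T. Bałaban, *Propagators and renormalization transformations for lattice gauge
theories. II*, Commun. Math. Phys. **96** (1984) 223–250 [`Balaban1984PropagatorsII`].

statement-level skeleton of published theorems with citation tags; proofs where landed; nothing here is a claim about the Yang–Mills
mass gap

THE PRINTED LOCUS (held text `paper:balaban1985-cmp99-background-propagators`, pp. 397–398 read first-hand).  (3.39)–(3.40) p. 397: the supremum norms `|λ|`
and the Hölder norms *"‖λ‖_β = max sup |R(U(Γ_{x,x′}))λ(x′) − λ(x)| ∕ |x − x′|^β … where Γ_{x,x′} is a shortest contour connecting points x and x′. It is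
understood that the η-scale is used in the above definitions. If we use another scale, then it is indicated explicitly by a superscript, e.g. ‖·‖^ξ"*; (3.44)
p. 398: the input side `‖λ‖_ε + |λ|` for `supp λ ⊂ Δ(y′)`; p. 398: *"All these inequalities are invariant with respect to gauge transformations of U"*; (3.3)
p. 390 (`D_U`), (3.35) p. 396 (the small-field gauge `U = e^{iηA}` on a cube); [4] (2.137) p. 247 (the pair parameter `t`), (2.45)–(2.46) p. 231, (2.51)–(2.52)
p. 232, Lemma 2.1 (2.60) p. 234.

THE POINT.  n06-d's INPUT classes of the N06 certificate are FLAT (no transporter): `bHS sI ε` (`loc y λ = supS + holS`, η-scale weight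
`wS ε z z′ = ((|z − z′|_T·η)^ε)⁻¹`, all pairs) on the site carrier `XSK`, `bHK bI ε` (`supK + holK`, ξ-scale weight `t(b,b′)^{−ε}` over r03's admissible
same-direction pairs) on the bond carrier `XBK`.  The kinematic letter `J_μ(U)` of p612121 (`(J_μλ)(b) = −R(U_μ(b₋))λ̂(b₋ + e_μ)` on the bonds of direction μ)
maps the first into the second; THIS FILE holds the pair-level facts that reading needs:
* §1 a `y′`-localized `λ` IS its restriction (`restrS_eq_of_isLoc`); every value is `≤ supS` (`abs_le_supS_of_isLoc`, `sum_abs_le_card_mul_supS`); `wS` is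
  symmetric; every η-weighted pair difference is `≤ holS` whichever end lies in the class (`wS_mul_abs_sub_le_holS`); the JUMP at the class boundary is paid
  by `holS` (`wS_mul_abs_le_holS_of_off`);
* §2 the distance dictionary `|chart s − chart s′|_T = supDist s s′` (`torusSupNorm_chartY_sub`, over `B9Ineq344TowerChart.T_eq_torusSupNorm` and
  `B3Bound323ZeroTorus.T_eq_supDist`), `wS_chartY`, `tpar_eq`; ★ `tpar_rpow_neg_le_wS_shift` (`t^{−ε} ≤ wS` on the shifted pair: same sup-distance, `Lʲ ≤ L^k`);
  ★ `tpar_rpow_neg_le_two_mul_wS` (`t^{−ε} ≤ 2·wS(z,w)` for a partner `w` within `2|s − s′|`, `0 ≤ ε ≤ 1`); `supDist_shift_partner_le`;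
* §3 (private: `‖R(g)v − R(g′)v‖ ≤ 2‖g − g′‖‖v‖` for contracting units) `norm_assembleK(_sub)_le`, `JcoKH_apply_of_dir_ne`,
  ★ `abs_JcoKH_sub_le` (the difference of `J_μλ` at two bonds of direction μ = TRANSPORT VARIATION `2‖U_μ(x) − U_μ(x′)‖·|λ|` + the shifted difference),
  `sIK_chartY`, `shift_injective'`, `JcoKH_apply_eq_zero_of_off`;
* §4 generic re-weighting of majorants between block norms by `len^γ` under the member facts (`hasMaj_weight_len_rpow`, `hasMaj_weight_source_inv_len`:
  p. 398 *"the choice of powers Lʲη is conventional"* with [4] (2.60)).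

HONEST SCOPE.  Finite-dimensional bookkeeping at def-Y's letters and n06-d's flat input norms; the transport-variation term is where the GAUGE enters (flat norms
are gauge-variant; print's transported norms are not) — nothing of [B9]'s estimates asserted; COUNT-NEUTRAL; N06 NOT discharged; one finite lattice at a time;
nothing continuum, nothing about the mass gap.  Cell `pub-ymgap` (HUMAN RULING D-0062), Track A node N06 [B9], rows 20–21 (bundle F7), seat `pub-ymgap-dag-n06-l`
(g18), 2026-08-28.
-/

noncomputable section

namespace Literature.MathematicalPhysics.QuantumFieldTheory.Balaban1983to89.B9GradViaDivLettersAtPinsHolderPairs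


open Node00 B6GlobalChartV1 B6KLevelCensusIndexV1 B9BackgroundsKLevelV1
open B9Eq39Adjoint (R R_zero R_neg R_inv_R R_add R_smul)
open Node00.OpsYNablaBridge (chartY shiftY_chartY chartY_eq)
open B9CoReadingCoords (XBK coordOpK assembleK blkBK)
open B9CoReadingCoordsH (coordOpKH coordOpKH_apply)
open B9CoReadingCoordsS (XSK blkSK sIK)
open B9CoReadingCoordsInput (restrK supK holK bHK supK_nonneg holK_nonneg holK_term_nonneg)
open B9CoReadingCoordsInputS (restrS supS holS bHS supS_nonneg holS_nonneg)
open B9CoReadingCoordsHolderS (wS wS_nonneg)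
open B9CoRealizesRelAtLetters (RelB relB_refl)
open LatticeFieldCalculus (supDist)
open B6Geom246MultiLevelTorus (geomT)
open B6Ineq2142KLevelV1 (β lvl)
open B9GeoNormsKLevelV1 (geo9K blkV1_level_le)
open B9Thm39ReadingCoords (cR39 cR39_nonneg coordBound39 basisBound39 abs_repr_le norm_sum_smul_basis_le)
open B9Thm34Ext (toB6)
open B9SectDSup (weightNorm)
open B11SectG (HasMaj BlockNorm)
open B9Thm312Whole (cNorm wt wt_nonneg GeoOK)
open B4TorusKernel.MultiPeriod (torusSupNorm)
open B6Prop22KLevelTorusCensusEta (nKT nKT_pos)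
open B9GradViaDivLettersAtPins (Jb Jb_apply JcoKH JcoKH_apply rJ dist_bI_sIK_shift_le supDist_shift_le_one abs_JcoKH_apply_le)

variable {𝔸 : Type} [NormedRing 𝔸] [NormedAlgebra ℂ 𝔸] [CompleteSpace 𝔸]
variable {d ℓ : ℕ} {hd : 1 ≤ d + 1} {hL : Odd (ℓ + 1) ∧ 1 < ℓ + 1} {b₀ b₁ : ℝ}
variable (i : KIdx d ℓ hd hL b₀ b₁)
variable {κ : Type} [Fintype κ]
/-! ## §1 The site input norm of a localized vector: every value is below `supS`, every weighted pair difference below `holS` -/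

section InputS

variable [DecidableRel (RelB i)] {sI : SiteY i → IBondY i} {y' : IBondY i} {lam : XSK κ i → ℝ}

omit [Fintype κ] in
/-- a vector localized in the class of `y′` IS its own restriction to that class. [cite: Balaban1985BackgroundPropagators, (3.44) p.398 («supp λ ⊂ Δ(y′)»), bookkeeping] -/
theorem restrS_eq_of_isLoc (hloc : ∀ p : XSK κ i, ¬ RelB i (sI p.1) y' → lam p = 0) : restrS i sI y' lam = lam := by
  funext p
  by_cases h : RelB i (sI p.1) y'
  · simp [restrS, h]
  · simp [restrS, h, hloc p h]

/-- every value of a `y′`-localized vector is below its class-restricted sup `supS`. [cite: Balaban1985BackgroundPropagators, (3.39) p.397, bookkeeping] -/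
theorem abs_le_supS_of_isLoc (hloc : ∀ p : XSK κ i, ¬ RelB i (sI p.1) y' → lam p = 0) (q : XSK κ i) : |lam q| ≤ supS i sI y' lam := by
  unfold supS
  rw [restrS_eq_of_isLoc i hloc]
  exact le_ciSup (f := fun p : XSK κ i => |lam p|) (Finite.bddAbove_range _) q

omit [Fintype κ] [DecidableRel (RelB i)] in
/-- the η-scale pair weight `wS` is symmetric (`|−x|_T = |x|_T`). [cite: Balaban1985BackgroundPropagators, (3.40) p.397, bookkeeping] -/
theorem wS_symm (α : ℝ) (z z' : SiteY i) : wS i α z z' = wS i α z' z := by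
  unfold wS
  rw [show z.1 - z'.1 = -(z'.1 - z.1) by abel, B6Geom246MultiLevelTorus.torusSupNorm_neg (B6MultiLevelTorusOperator.one_le_of_mem z.2)]

/-- **EVERY η-WEIGHTED PAIR DIFFERENCE OF A `y′`-LOCALIZED VECTOR IS BELOW `holS`**, whichever end of the pair lies in the class (the other end reads `0`
when outside: the jump at the class boundary is counted, as print's `‖λ‖_ε` for `λ ∈ C^ε₀`). [cite: Balaban1985BackgroundPropagators, (3.40) p.397 + (3.44) p.398] -/
theorem wS_mul_abs_sub_le_holS (hloc : ∀ p : XSK κ i, ¬ RelB i (sI p.1) y' → lam p = 0) (ε : ℝ) {z z' : SiteY i} (hne : z ≠ z')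
    (s : Fin (d + 1) × κ × κ) : wS i ε z z' * |lam (z', s) - lam (z, s)| ≤ holS i sI ε y' lam := by
  have hres := restrS_eq_of_isLoc i hloc
  unfold holS
  rw [hres]
  by_cases hz : RelB i (sI z) y'
  · have h := le_ciSup (f := fun q : (SiteY i × SiteY i) × Fin (d + 1) × κ × κ =>
      (if q.1.1 ≠ q.1.2 ∧ RelB i (sI q.1.1) y' then wS i ε q.1.1 q.1.2 * |lam (q.1.2, q.2) - lam (q.1.1, q.2)| else 0))
      (Finite.bddAbove_range _) ((z, z'), s)
    simp only [if_pos (And.intro hne hz)] at h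
    exact h
  · by_cases hz' : RelB i (sI z') y'
    · have h := le_ciSup (f := fun q : (SiteY i × SiteY i) × Fin (d + 1) × κ × κ =>
        (if q.1.1 ≠ q.1.2 ∧ RelB i (sI q.1.1) y' then wS i ε q.1.1 q.1.2 * |lam (q.1.2, q.2) - lam (q.1.1, q.2)| else 0))
        (Finite.bddAbove_range _) ((z', z), s)
      simp only [if_pos (And.intro hne.symm hz')] at h
      rw [wS_symm i ε z' z, abs_sub_comm] at h
      exact h
    · rw [hloc (z, s) hz, hloc (z', s) hz', sub_zero, abs_zero, mul_zero]
      exact Real.iSup_nonneg fun q => by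
        split_ifs
        · exact mul_nonneg (wS_nonneg i ε _ _) (abs_nonneg _)
        · exact le_rfl

/-- **THE JUMP AT THE CLASS BOUNDARY IS PAID BY `holS`**: if `w ≠ z` lies outside the class of `y′`, then `wS(z,w)·|λ(z,s)| ≤ holS λ`.
[cite: Balaban1985BackgroundPropagators, (3.40) p.397 + (3.44) p.398 («λ ∈ C^ε₀(Δ̃(y′))»)] -/
theorem wS_mul_abs_le_holS_of_off (hloc : ∀ p : XSK κ i, ¬ RelB i (sI p.1) y' → lam p = 0) (ε : ℝ) {z w : SiteY i} (hne : z ≠ w)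
    (hw : ¬ RelB i (sI w) y') (s : Fin (d + 1) × κ × κ) : wS i ε z w * |lam (z, s)| ≤ holS i sI ε y' lam := by
  have h := wS_mul_abs_sub_le_holS i hloc ε hne s
  rwa [hloc (w, s) hw, zero_sub, abs_neg] at h

end InputS

/-! ## §2 The distance dictionary: the η-scale weight of `holS` on charted torus sites vs the ξ-scale weight `t^{−ε}` of `holK` -/

section Dist

omit [CompleteSpace 𝔸] in
/-- the torus sup-distance of two charted sites is r15's `supDist` of the sites. [cite: Balaban1984PropagatorsII, (2.46) p.231, dictionary] -/
theorem torusSupNorm_chartY_sub (s s' : Site (PV d ℓ i.m i.K hd hL) 0) :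
    torusSupNorm (toKT i).NB ((chartY i s).1 - (chartY i s').1) = (supDist s s' : ℝ) := by
  rw [← B3Bound323ZeroTorus.T_eq_supDist, B9Ineq344TowerChart.T_eq_torusSupNorm i.hN]
  rfl

omit [CompleteSpace 𝔸] in
/-- the η-scale weight on charted sites: `wS ε (chart s) (chart s′) = ((|s − s′|_∞ ∕ L^k)^ε)⁻¹`. [cite: Balaban1985BackgroundPropagators, (3.40) p.397, dictionary] -/
theorem wS_chartY (ε : ℝ) (s s' : Site (PV d ℓ i.m i.K hd hL) 0) :
    wS i ε (chartY i s) (chartY i s') = (((supDist s s' : ℝ) / (((ℓ + 1 : ℕ) : ℝ)) ^ i.k) ^ ε)⁻¹ := by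
  unfold wS
  rw [torusSupNorm_chartY_sub, B3TorusRadialSums.supDist_comm]
  norm_cast

omit [CompleteSpace 𝔸] in
/-- the ξ-scale pair parameter at a same-direction pair: `t(⟨s,μ⟩,⟨s′,μ⟩) = |s − s′|_∞ ∕ L^{j(s)}`. [cite: Balaban1984PropagatorsII, (2.137) p.247, dictionary] -/
theorem tpar_eq (s s' : Site (PV d ℓ i.m i.K hd hL) 0) (μ : Fin (d + 1)) :
    tpar i ⟨s, μ⟩ ⟨s', μ⟩ = (supDist s s' : ℝ) / (((ℓ + 1 : ℕ) : ℝ)) ^ (blkV1 i.hN i.D (⟨s, μ⟩ : FBondY i)).1.1 := rfl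

omit [CompleteSpace 𝔸] in
/-- **THE ξ-SCALE WEIGHT OF `holK` IS BELOW THE η-SCALE WEIGHT OF `holS` ON THE SHIFTED PAIR**: for `s ≠ s′` and `0 ≤ ε`,
`t(⟨s,μ⟩,⟨s′,μ⟩)^{−ε} ≤ wS ε (chart(s + e_ν)) (chart(s′ + e_ν))` — the shifted pair has the same sup-distance and `L^{j(s)} ≤ L^k`.
[cite: Balaban1985BackgroundPropagators, (3.40)–(3.41) p.397; Balaban1984PropagatorsII, (2.137) p.247] -/
theorem tpar_rpow_neg_le_wS_shift {ε : ℝ} (hε : 0 ≤ ε) {s s' : Site (PV d ℓ i.m i.K hd hL) 0} (hne : s ≠ s') (μ ν : Fin (d + 1)) :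
    tpar i ⟨s, μ⟩ ⟨s', μ⟩ ^ (-ε) ≤ wS i ε (chartY i (s.shift ν)) (chartY i (s'.shift ν)) := by
  rw [wS_chartY, B6Grad2LegLettersKLevelV1.supDist_shift, tpar_eq, Real.rpow_neg (by positivity)]
  have hn : (0 : ℝ) < (supDist s s' : ℝ) := by
    have h0 : supDist s s' ≠ 0 := fun h => hne ((B3TorusRadialSums.supDist_eq_zero_iff s s').1 h)
    exact_mod_cast Nat.pos_of_ne_zero h0
  have hL1 : (1 : ℝ) ≤ ((ℓ + 1 : ℕ) : ℝ) := by exact_mod_cast Nat.succ_le_succ (Nat.zero_le ℓ)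
  have hj0 : (0 : ℝ) < (((ℓ + 1 : ℕ) : ℝ)) ^ (blkV1 i.hN i.D (⟨s, μ⟩ : FBondY i)).1.1 := by positivity
  have hk0 : (0 : ℝ) < (((ℓ + 1 : ℕ) : ℝ)) ^ i.k := by positivity
  have hjk : (((ℓ + 1 : ℕ) : ℝ)) ^ (blkV1 i.hN i.D (⟨s, μ⟩ : FBondY i)).1.1 ≤ (((ℓ + 1 : ℕ) : ℝ)) ^ i.k :=
    pow_le_pow_right₀ hL1 (blkV1_level_le i ⟨s, μ⟩)
  refine inv_anti₀ (Real.rpow_pos_of_pos (div_pos hn hk0) ε) ?_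
  exact Real.rpow_le_rpow (div_pos hn hk0).le (div_le_div_of_nonneg_left hn.le hj0 hjk) hε

omit [CompleteSpace 𝔸] in
/-- **THE JUMP WEIGHT**: for `s ≠ s′`, `0 ≤ ε ≤ 1` and a charted site `w` within `2|s − s′|_∞` of `z`, `t(⟨s,μ⟩,⟨s′,μ⟩)^{−ε}·(wS ε z w)⁻¹ ≤ 2`
(`= (L^{j(s)}∕|s−s′|)^ε·(|z−w|_T∕L^k)^ε ≤ (2L^{j(s)}∕L^k)^ε ≤ 2^ε ≤ 2`). [cite: Balaban1985BackgroundPropagators, (3.40)–(3.41) p.397; Balaban1984PropagatorsII, (2.137) p.247] -/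
theorem tpar_rpow_neg_le_two_mul_wS {ε : ℝ} (hε : 0 ≤ ε) (hε1 : ε ≤ 1) {s s' : Site (PV d ℓ i.m i.K hd hL) 0} (hne : s ≠ s') (μ : Fin (d + 1))
    {a a' : Site (PV d ℓ i.m i.K hd hL) 0} (hne' : a ≠ a') (hw : (supDist a a' : ℝ) ≤ 2 * (supDist s s' : ℝ)) :
    tpar i ⟨s, μ⟩ ⟨s', μ⟩ ^ (-ε) ≤ 2 * wS i ε (chartY i a) (chartY i a') := by
  rw [wS_chartY, tpar_eq, Real.rpow_neg (by positivity), ← Real.inv_rpow (by positivity), ← Real.inv_rpow (by positivity),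
    inv_div, inv_div]
  have hn : (0 : ℝ) < (supDist s s' : ℝ) := by
    have h0 : supDist s s' ≠ 0 := fun h => hne ((B3TorusRadialSums.supDist_eq_zero_iff s s').1 h)
    exact_mod_cast Nat.pos_of_ne_zero h0
  have hn' : (0 : ℝ) < (supDist a a' : ℝ) := by
    have h0 : supDist a a' ≠ 0 := fun h => hne' ((B3TorusRadialSums.supDist_eq_zero_iff a a').1 h)
    exact_mod_cast Nat.pos_of_ne_zero h0
  have hL1 : (1 : ℝ) ≤ ((ℓ + 1 : ℕ) : ℝ) := by exact_mod_cast Nat.succ_le_succ (Nat.zero_le ℓ)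
  have hjk : (((ℓ + 1 : ℕ) : ℝ)) ^ (blkV1 i.hN i.D (⟨s, μ⟩ : FBondY i)).1.1 ≤ (((ℓ + 1 : ℕ) : ℝ)) ^ i.k :=
    pow_le_pow_right₀ hL1 (blkV1_level_le i ⟨s, μ⟩)
  have hk0 : (0 : ℝ) < (((ℓ + 1 : ℕ) : ℝ)) ^ i.k := by positivity
  -- `L^{j(s)} ∕ |s − s′| ≤ 2·L^k ∕ |a − a′|`
  have hbase : (((ℓ + 1 : ℕ) : ℝ)) ^ (blkV1 i.hN i.D (⟨s, μ⟩ : FBondY i)).1.1 / (supDist s s' : ℝ) ≤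
      2 * ((((ℓ + 1 : ℕ) : ℝ)) ^ i.k / (supDist a a' : ℝ)) := by
    rw [mul_div_assoc', div_le_div_iff₀ hn hn']
    calc (((ℓ + 1 : ℕ) : ℝ)) ^ (blkV1 i.hN i.D (⟨s, μ⟩ : FBondY i)).1.1 * (supDist a a' : ℝ)
        ≤ (((ℓ + 1 : ℕ) : ℝ)) ^ i.k * (2 * (supDist s s' : ℝ)) := mul_le_mul hjk hw hn'.le hk0.le
      _ = 2 * (((ℓ + 1 : ℕ) : ℝ)) ^ i.k * (supDist s s' : ℝ) := by ring
  have h2ε : (2 : ℝ) ^ ε ≤ 2 := by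
    calc (2 : ℝ) ^ ε ≤ (2 : ℝ) ^ (1 : ℝ) := Real.rpow_le_rpow_of_exponent_le (by norm_num) hε1
      _ = 2 := Real.rpow_one 2
  have hpos : 0 ≤ (((ℓ + 1 : ℕ) : ℝ)) ^ i.k / (supDist a a' : ℝ) := by positivity
  calc ((((ℓ + 1 : ℕ) : ℝ)) ^ (blkV1 i.hN i.D (⟨s, μ⟩ : FBondY i)).1.1 / (supDist s s' : ℝ)) ^ ε
      ≤ (2 * ((((ℓ + 1 : ℕ) : ℝ)) ^ i.k / (supDist a a' : ℝ))) ^ ε := Real.rpow_le_rpow (by positivity) hbase hε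
    _ = (2 : ℝ) ^ ε * ((((ℓ + 1 : ℕ) : ℝ)) ^ i.k / (supDist a a' : ℝ)) ^ ε := Real.mul_rpow (by norm_num) hpos
    _ ≤ 2 * ((((ℓ + 1 : ℕ) : ℝ)) ^ i.k / (supDist a a' : ℝ)) ^ ε :=
        mul_le_mul_of_nonneg_right h2ε (Real.rpow_nonneg hpos ε)

omit [CompleteSpace 𝔸] in
/-- the two candidate partners of the jump: `|(s + e_μ) − s|_∞ ≤ 2|s − s′|_∞` and `|(s + e_μ) − s′|_∞ ≤ 2|s − s′|_∞` for `s ≠ s′`.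
[cite: Balaban1984PropagatorsII, (2.46) p.231, bookkeeping] -/
theorem supDist_shift_partner_le {s s' : Site (PV d ℓ i.m i.K hd hL) 0} (hne : s ≠ s') (μ : Fin (d + 1)) :
    (supDist (s.shift μ) s : ℝ) ≤ 2 * (supDist s s' : ℝ) ∧ (supDist (s.shift μ) s' : ℝ) ≤ 2 * (supDist s s' : ℝ) := by
  have hn : (1 : ℝ) ≤ (supDist s s' : ℝ) := by
    have h0 : supDist s s' ≠ 0 := fun h => hne ((B3TorusRadialSums.supDist_eq_zero_iff s s').1 h)
    exact_mod_cast Nat.pos_of_ne_zero h0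
  have h1 : (supDist (s.shift μ) s : ℝ) ≤ 1 := by
    rw [B3TorusRadialSums.supDist_comm]; exact_mod_cast supDist_shift_le_one i s μ
  refine ⟨by linarith, ?_⟩
  have htri' : (supDist (s.shift μ) s' : ℝ) ≤ (supDist (s.shift μ) s : ℝ) + (supDist s s' : ℝ) :=
    B3KernelConvolutionTorus.supDist_triangle_real (s.shift μ) s s'
  linarith

end Dist

/-! ## §3 The letter `J_μ(U)` at two bonds of direction `μ`: the transport-variation term and the shifted difference -/

section Pointwise

variable (b : Module.Basis κ ℝ 𝔸) [FiniteDimensional ℝ 𝔸] (B : B9.Backgrounds) (cfg : B.Cfg → CfgY 𝔸 i)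

omit [NormedAlgebra ℂ 𝔸] [CompleteSpace 𝔸] [FiniteDimensional ℝ 𝔸] [Fintype κ] in
/-- a contracting unit conjugates contractively: `‖g v g⁻¹‖ ≤ ‖v‖` (twin of n06-w5's ∕ `B9Eq310Hermitian.norm_R_le`). [folklore] -/
private theorem norm_R_le' {g : 𝔸ˣ} (h1 : ‖(g : 𝔸)‖ ≤ 1) (h2 : ‖((g⁻¹ : 𝔸ˣ) : 𝔸)‖ ≤ 1) (v : 𝔸) : ‖R g v‖ ≤ ‖v‖ := by
  rw [B9Eq39Adjoint.R_def]
  calc ‖(g : 𝔸) * v * ((g⁻¹ : 𝔸ˣ) : 𝔸)‖ ≤ ‖(g : 𝔸) * v‖ * ‖((g⁻¹ : 𝔸ˣ) : 𝔸)‖ := norm_mul_le _ _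
    _ ≤ (‖(g : 𝔸)‖ * ‖v‖) * ‖((g⁻¹ : 𝔸ˣ) : 𝔸)‖ := mul_le_mul_of_nonneg_right (norm_mul_le _ _) (norm_nonneg _)
    _ ≤ (1 * ‖v‖) * 1 := mul_le_mul (mul_le_mul_of_nonneg_right h1 (norm_nonneg _)) h2 (norm_nonneg _) (by positivity)
    _ = ‖v‖ := by ring

omit [NormedAlgebra ℂ 𝔸] [CompleteSpace 𝔸] [FiniteDimensional ℝ 𝔸] [Fintype κ] in
/-- **THE ADJOINT TRANSPORT VARIES LIPSCHITZ-CONTINUOUSLY WITH THE LINK VARIABLE**: for contracting units `g, g′` (`‖g‖, ‖g⁻¹‖, ‖g′‖, ‖g′⁻¹‖ ≤ 1`),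
`‖R(g)v − R(g′)v‖ ≤ 2‖g − g′‖‖v‖` (`gvg⁻¹ − g′vg′⁻¹ = (g − g′)vg⁻¹ + g′v·g⁻¹(g′ − g)g′⁻¹`). [folklore] -/
private theorem norm_R_sub_R_le {g g' : 𝔸ˣ} (h2 : ‖((g⁻¹ : 𝔸ˣ) : 𝔸)‖ ≤ 1) (h1' : ‖(g' : 𝔸)‖ ≤ 1) (h2' : ‖((g'⁻¹ : 𝔸ˣ) : 𝔸)‖ ≤ 1) (v : 𝔸) :
    ‖R g v - R g' v‖ ≤ 2 * ‖(g : 𝔸) - (g' : 𝔸)‖ * ‖v‖ := by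
  have hmi : (g' : 𝔸) * ((g'⁻¹ : 𝔸ˣ) : 𝔸) = 1 := Units.mul_inv g'
  have him : ((g⁻¹ : 𝔸ˣ) : 𝔸) * (g : 𝔸) = 1 := Units.inv_mul g
  have key : R g v - R g' v =
      ((g : 𝔸) - (g' : 𝔸)) * v * ((g⁻¹ : 𝔸ˣ) : 𝔸) + (g' : 𝔸) * v * (((g⁻¹ : 𝔸ˣ) : 𝔸) * ((g' : 𝔸) - (g : 𝔸)) * ((g'⁻¹ : 𝔸ˣ) : 𝔸)) := by
    rw [B9Eq39Adjoint.R_def, B9Eq39Adjoint.R_def]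
    have e : (g' : 𝔸) * v * (((g⁻¹ : 𝔸ˣ) : 𝔸) * ((g' : 𝔸) - (g : 𝔸)) * ((g'⁻¹ : 𝔸ˣ) : 𝔸)) =
        (g' : 𝔸) * v * ((g⁻¹ : 𝔸ˣ) : 𝔸) * ((g' : 𝔸) * ((g'⁻¹ : 𝔸ˣ) : 𝔸)) -
          (g' : 𝔸) * v * (((g⁻¹ : 𝔸ˣ) : 𝔸) * (g : 𝔸)) * ((g'⁻¹ : 𝔸ˣ) : 𝔸) := by noncomm_ring
    rw [e, hmi, him, mul_one, mul_one]
    noncomm_ring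
  rw [key]
  have hA : ‖((g : 𝔸) - (g' : 𝔸)) * v * ((g⁻¹ : 𝔸ˣ) : 𝔸)‖ ≤ ‖(g : 𝔸) - (g' : 𝔸)‖ * ‖v‖ := by
    calc ‖((g : 𝔸) - (g' : 𝔸)) * v * ((g⁻¹ : 𝔸ˣ) : 𝔸)‖ ≤ ‖((g : 𝔸) - (g' : 𝔸)) * v‖ * ‖((g⁻¹ : 𝔸ˣ) : 𝔸)‖ := norm_mul_le _ _
      _ ≤ (‖(g : 𝔸) - (g' : 𝔸)‖ * ‖v‖) * 1 := mul_le_mul (norm_mul_le _ _) h2 (norm_nonneg _) (by positivity)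
      _ = ‖(g : 𝔸) - (g' : 𝔸)‖ * ‖v‖ := mul_one _
  have hB : ‖(g' : 𝔸) * v * (((g⁻¹ : 𝔸ˣ) : 𝔸) * ((g' : 𝔸) - (g : 𝔸)) * ((g'⁻¹ : 𝔸ˣ) : 𝔸))‖ ≤ ‖(g : 𝔸) - (g' : 𝔸)‖ * ‖v‖ := by
    have hin : ‖((g⁻¹ : 𝔸ˣ) : 𝔸) * ((g' : 𝔸) - (g : 𝔸)) * ((g'⁻¹ : 𝔸ˣ) : 𝔸)‖ ≤ ‖(g : 𝔸) - (g' : 𝔸)‖ := by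
      calc ‖((g⁻¹ : 𝔸ˣ) : 𝔸) * ((g' : 𝔸) - (g : 𝔸)) * ((g'⁻¹ : 𝔸ˣ) : 𝔸)‖
          ≤ ‖((g⁻¹ : 𝔸ˣ) : 𝔸) * ((g' : 𝔸) - (g : 𝔸))‖ * ‖((g'⁻¹ : 𝔸ˣ) : 𝔸)‖ := norm_mul_le _ _
        _ ≤ (‖((g⁻¹ : 𝔸ˣ) : 𝔸)‖ * ‖(g' : 𝔸) - (g : 𝔸)‖) * 1 := mul_le_mul (norm_mul_le _ _) h2' (norm_nonneg _) (by positivity)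
        _ ≤ (1 * ‖(g' : 𝔸) - (g : 𝔸)‖) * 1 := by gcongr
        _ = ‖(g : 𝔸) - (g' : 𝔸)‖ := by rw [one_mul, mul_one, norm_sub_rev]
    calc ‖(g' : 𝔸) * v * (((g⁻¹ : 𝔸ˣ) : 𝔸) * ((g' : 𝔸) - (g : 𝔸)) * ((g'⁻¹ : 𝔸ˣ) : 𝔸))‖
        ≤ ‖(g' : 𝔸) * v‖ * ‖((g⁻¹ : 𝔸ˣ) : 𝔸) * ((g' : 𝔸) - (g : 𝔸)) * ((g'⁻¹ : 𝔸ˣ) : 𝔸)‖ := norm_mul_le _ _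
      _ ≤ (‖(g' : 𝔸)‖ * ‖v‖) * ‖(g : 𝔸) - (g' : 𝔸)‖ := mul_le_mul (norm_mul_le _ _) hin (norm_nonneg _) (by positivity)
      _ ≤ (1 * ‖v‖) * ‖(g : 𝔸) - (g' : 𝔸)‖ := by gcongr
      _ = ‖(g : 𝔸) - (g' : 𝔸)‖ * ‖v‖ := by ring
  calc _ ≤ ‖((g : 𝔸) - (g' : 𝔸)) * v * ((g⁻¹ : 𝔸ˣ) : 𝔸)‖ + ‖(g' : 𝔸) * v * (((g⁻¹ : 𝔸ˣ) : 𝔸) * ((g' : 𝔸) - (g : 𝔸)) * ((g'⁻¹ : 𝔸ˣ) : 𝔸))‖ :=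
        norm_add_le _ _
    _ ≤ ‖(g : 𝔸) - (g' : 𝔸)‖ * ‖v‖ + ‖(g : 𝔸) - (g' : 𝔸)‖ * ‖v‖ := add_le_add hA hB
    _ = 2 * ‖(g : 𝔸) - (g' : 𝔸)‖ * ‖v‖ := by ring

omit [CompleteSpace 𝔸] [FiniteDimensional ℝ 𝔸] in
/-- the re-assembled slice at two sites differs by the re-assembled difference: `Φ(z) − Φ(z′) = Σ_a (λ(z,a) − λ(z′,a))·b_a`, of norm `≤ basisBound·Σ_a|λ(z,a) − λ(z′,a)|`.
[cite: Balaban1985BackgroundPropagators, p.389 (coordinates), dictionary] -/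
theorem norm_assembleK_sub_le {S D : Type} (ν : D) (c' : κ) (f : S × D × κ × κ → ℝ) (z z' : S) :
    ‖assembleK b ν c' f z - assembleK b ν c' f z'‖ ≤ basisBound39 b * ∑ a, |f (z, ν, a, c') - f (z', ν, a, c')| := by
  have e : assembleK b ν c' f z - assembleK b ν c' f z' = ∑ a, (f (z, ν, a, c') - f (z', ν, a, c')) • b a := by
    simp only [assembleK, ← Finset.sum_sub_distrib, sub_smul]
  rw [e]
  exact norm_sum_smul_basis_le b _

omit [CompleteSpace 𝔸] [FiniteDimensional ℝ 𝔸] in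
/-- the re-assembled slice has norm `≤ basisBound·Σ_a|λ(z,a)|`. [cite: Balaban1985BackgroundPropagators, p.389 (coordinates), dictionary] -/
theorem norm_assembleK_le {S D : Type} (ν : D) (c' : κ) (f : S × D × κ × κ → ℝ) (z : S) :
    ‖assembleK b ν c' f z‖ ≤ basisBound39 b * ∑ a, |f (z, ν, a, c')| :=
  norm_sum_smul_basis_le b _

omit [FiniteDimensional ℝ 𝔸] in
/-- `J_μ` vanishes on the bonds of the other directions. [cite: Balaban1985BackgroundPropagators, (3.3) p.390, bookkeeping] -/
theorem JcoKH_apply_of_dir_ne (μ : Fin (d + 1)) (U₁ : B.Cfg) (lam : XSK κ i → ℝ) {p : XBK κ i} (h : p.1.dir ≠ μ) :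
    JcoKH i b B cfg μ U₁ lam p = 0 := by
  rw [JcoKH_apply, Jb_apply, if_neg h, map_zero, Finsupp.zero_apply]

/-- ★ **THE DIFFERENCE OF `J_μλ` AT TWO BONDS OF DIRECTION `μ`**: with `z = chart(x + e_μ)`, `z′ = chart(x′ + e_μ)` and contracting links,
`|(J_μλ)(⟨x,μ⟩,s) − (J_μλ)(⟨x′,μ⟩,s)| ≤ coordBound·(2‖U_μ(x) − U_μ(x′)‖·basisBound·Σ_a|λ(z,a)| + basisBound·Σ_a|λ(z,a) − λ(z′,a)|)` — the
TRANSPORT-VARIATION term (gauge-variant: it is small only where `U_μ` varies little, the content of the small-field gauge of (3.35)) plus the shifted difference.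
[cite: Balaban1985BackgroundPropagators, (3.3) p.390 + (3.35) p.396 + (3.40) p.397] -/
theorem abs_JcoKH_sub_le (μ : Fin (d + 1)) (U₁ : B.Cfg)
    (hU : ∀ (ν : Fin (d + 1)) (s : Site (PV d ℓ i.m i.K hd hL) 0), ‖(cfg U₁ ν s : 𝔸)‖ ≤ 1 ∧ ‖(((cfg U₁ ν s)⁻¹ : 𝔸ˣ) : 𝔸)‖ ≤ 1)
    (lam : XSK κ i → ℝ) (x x' : Site (PV d ℓ i.m i.K hd hL) 0) (s : Fin (d + 1) × κ × κ) :
    |JcoKH i b B cfg μ U₁ lam (⟨x, μ⟩, s) - JcoKH i b B cfg μ U₁ lam (⟨x', μ⟩, s)| ≤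
      coordBound39 b * (2 * ‖(cfg U₁ μ x : 𝔸) - (cfg U₁ μ x' : 𝔸)‖ * (basisBound39 b * ∑ a, |lam (chartY i (x.shift μ), s.1, a, s.2.2)|)
        + basisBound39 b * ∑ a, |lam (chartY i (x.shift μ), s.1, a, s.2.2) - lam (chartY i (x'.shift μ), s.1, a, s.2.2)|) := by
  set Φ : SiteY i → 𝔸 := assembleK b s.1 s.2.2 lam with hΦ
  have e : JcoKH i b B cfg μ U₁ lam (⟨x, μ⟩, s) - JcoKH i b B cfg μ U₁ lam (⟨x', μ⟩, s) =
      -(b.repr (R (cfg U₁ μ x) (Φ (chartY i (x.shift μ))) - R (cfg U₁ μ x') (Φ (chartY i (x'.shift μ)))) s.2.1) := by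
    rw [JcoKH_apply, JcoKH_apply, Jb_apply, Jb_apply, if_pos rfl, if_pos rfl, map_neg, map_neg, map_sub]
    simp only [Finsupp.neg_apply, Finsupp.sub_apply, hΦ]
    ring
  rw [e, abs_neg]
  refine (abs_repr_le b _ _).trans (mul_le_mul_of_nonneg_left ?_ (norm_nonneg _))
  have hsplit : R (cfg U₁ μ x) (Φ (chartY i (x.shift μ))) - R (cfg U₁ μ x') (Φ (chartY i (x'.shift μ))) =
      (R (cfg U₁ μ x) (Φ (chartY i (x.shift μ))) - R (cfg U₁ μ x') (Φ (chartY i (x.shift μ)))) +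
        R (cfg U₁ μ x') (Φ (chartY i (x.shift μ)) - Φ (chartY i (x'.shift μ))) := by
    rw [B9Eq39Adjoint.R_sub]; abel
  rw [hsplit]
  refine (norm_add_le _ _).trans (add_le_add ?_ ?_)
  · refine (norm_R_sub_R_le (hU μ x).2 (hU μ x').1 (hU μ x').2 _).trans ?_
    exact mul_le_mul_of_nonneg_left (norm_assembleK_le b s.1 s.2.2 lam _) (by positivity)
  · exact (norm_R_le' (hU μ x').1 (hU μ x').2 _).trans (norm_assembleK_sub_le b s.1 s.2.2 lam _ _)

end Pointwise

/-! ## §3b Support and slice sums of `J_μλ` for a localized `λ` -/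

section Support

variable (b : Module.Basis κ ℝ 𝔸) [FiniteDimensional ℝ 𝔸] (B : B9.Backgrounds) (cfg : B.Cfg → CfgY 𝔸 i)
variable [DecidableRel (RelB i)] {bI : FBondY i → IBondY i}

omit [CompleteSpace 𝔸] [DecidableRel (RelB i)] in
/-- the induced site block map at a charted site: `sIK bI (chart s) = bI ⟨s, e₀⟩`. [cite: Balaban1984PropagatorsII, (2.45) p.231, bookkeeping] -/
theorem sIK_chartY (bI : FBondY i → IBondY i) (s : Site (PV d ℓ i.m i.K hd hL) 0) : sIK i bI (chartY i s) = bI ⟨s, 0⟩ := by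
  show bI ⟨(boxEquiv i.hN).symm (boxEquiv i.hN s), 0⟩ = bI ⟨s, 0⟩
  rw [Equiv.symm_apply_apply]

omit [CompleteSpace 𝔸] [DecidableRel (RelB i)] in
/-- the lattice shift is injective. [cite: Balaban1984PropagatorsII, (2.1) p.224, bookkeeping] -/
theorem shift_injective' {x x' : Site (PV d ℓ i.m i.K hd hL) 0} {μ : Fin (d + 1)} (h : x.shift μ = x'.shift μ) : x = x' := by
  calc x = (x.shift μ).unshift μ := (Node00.OpsYNablaBridge.unshift_shift i x μ).symm
    _ = (x'.shift μ).unshift μ := by rw [h]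
    _ = x' := Node00.OpsYNablaBridge.unshift_shift i x' μ

omit [DecidableRel (RelB i)] in
/-- off the class of `y′` at the READ site `chart(p₋ + e_μ)`, `J_μλ` of a `y′`-localized `λ` vanishes at `p`. [cite: Balaban1985BackgroundPropagators, (3.3) p.390, bookkeeping] -/
theorem JcoKH_apply_eq_zero_of_off (μ : Fin (d + 1)) (U₁ : B.Cfg)
    (hU : ∀ (ν : Fin (d + 1)) (s : Site (PV d ℓ i.m i.K hd hL) 0), ‖(cfg U₁ ν s : 𝔸)‖ ≤ 1 ∧ ‖(((cfg U₁ ν s)⁻¹ : 𝔸ˣ) : 𝔸)‖ ≤ 1)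
    {y' : IBondY i} {lam : XSK κ i → ℝ} (hloc : ∀ p : XSK κ i, ¬ RelB i (sIK i bI p.1) y' → lam p = 0) {p : XBK κ i}
    (hp : ¬ RelB i (sIK i bI (chartY i (p.1.src.shift μ))) y') : JcoKH i b B cfg μ U₁ lam p = 0 := by
  have h := abs_JcoKH_apply_le i b B cfg μ U₁ hU lam p
  have h0 : ∑ a, |lam (chartY i (p.1.src.shift μ), p.2.1, a, p.2.2.2)| = 0 :=
    Finset.sum_eq_zero fun a _ => by rw [hloc (chartY i (p.1.src.shift μ), p.2.1, a, p.2.2.2) hp, abs_zero]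
  rw [h0, mul_zero, mul_zero] at h
  exact abs_eq_zero.1 (le_antisymm h (abs_nonneg _))

/-- the slice sums of a `y′`-localized `λ` are below `|κ|·supS`. [cite: Balaban1985BackgroundPropagators, (3.39) p.397, bookkeeping] -/
theorem sum_abs_le_card_mul_supS {sI : SiteY i → IBondY i} {y' : IBondY i} {lam : XSK κ i → ℝ}
    (hloc : ∀ p : XSK κ i, ¬ RelB i (sI p.1) y' → lam p = 0) (z : SiteY i) (ν : Fin (d + 1)) (c' : κ) :
    ∑ a, |lam (z, ν, a, c')| ≤ (Fintype.card κ : ℝ) * supS i sI y' lam := by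
  calc ∑ a, |lam (z, ν, a, c')| ≤ ∑ _a : κ, supS i sI y' lam := Finset.sum_le_sum fun a _ => abs_le_supS_of_isLoc i hloc _
    _ = (Fintype.card κ : ℝ) * supS i sI y' lam := by rw [Finset.sum_const, nsmul_eq_mul, Finset.card_univ]

end Support

/-! ## §4 Re-weighting block-norm majorants by powers of the scale length ([4] (2.60); p. 398) -/

section Weight

open B9RWSums343to347Whole (Facts347)
open B9RWSums346Schur (scaleTransfer_len_rpow)

variable {g : B9.Geometry} [Fintype g.Site] {R₀ : ℝ} {H₀ : Prop}
variable {F₁ F₂ : Type} [AddCommGroup F₁] [Module ℝ F₁] [AddCommGroup F₂] [Module ℝ F₂]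

/-- **RE-WEIGHTING BOTH CLASSES BY `(Lʲη)^γ`** (p. 398: *"the choice of powers Lʲη is conventional"*; [4] (2.60)): a majorant `C·e^{−rd}` between two block norms
is the majorant `C·L^{|γ|}·e^{−(r−αδ)d}` between the norms re-weighted by `len^γ`, `|γ| ≤ 4`, under the member facts. [cite: Balaban1985BackgroundPropagators, p.398 (remark after (3.47)); Balaban1984PropagatorsII, Lemma 2.1 (2.60) p.234] -/
theorem hasMaj_weight_len_rpow (hG : GeoOK g) {dF : ℕ} {δ α L₀ : ℝ} (hF : Facts347 g R₀ H₀ dF δ α L₀)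
    {b₁ : BlockNorm (toB6 g R₀ H₀) F₁} {b₂ : BlockNorm (toB6 g R₀ H₀) F₂} {T : F₁ →ₗ[ℝ] F₂} {C r : ℝ} (γ : ℝ) (hγ : |γ| ≤ 4) (hC : 0 ≤ C)
    (h : HasMaj b₁ b₂ T (fun a a' => C * Real.exp (-(r * g.dist a a')))) :
    HasMaj (weightNorm b₁ (fun y => g.len y ^ γ) fun y => Real.rpow_nonneg (hG.lenle y) γ)
      (weightNorm b₂ (fun y => g.len y ^ γ) fun y => Real.rpow_nonneg (hG.lenle y) γ) T
      (fun a a' => C * g.L ^ |γ| * Real.exp (-((r - α * δ) * g.dist a a'))) := by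
  refine B9SectDSup.HasMaj.weight _ _ h fun y y' => ?_
  have h1 := scaleTransfer_len_rpow hF γ hγ y' y
  rw [hG.symm y' y] at h1
  -- h1 : e^{−αδd(y,y′)}·(len y)^γ ≤ L^{|γ|}·(len y′)^γ
  have hsplit : Real.exp (-(r * g.dist y y')) = Real.exp (-((r - α * δ) * g.dist y y')) * Real.exp (-(α * δ * g.dist y y')) := by
    rw [← Real.exp_add]; congr 1; ring
  have hE : 0 ≤ C * Real.exp (-((r - α * δ) * g.dist y y')) := mul_nonneg hC (Real.exp_nonneg _)
  calc g.len y ^ γ * (C * Real.exp (-(r * g.dist y y')))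
      = C * Real.exp (-((r - α * δ) * g.dist y y')) * (Real.exp (-(α * δ * g.dist y y')) * g.len y ^ γ) := by rw [hsplit]; ring
    _ ≤ C * Real.exp (-((r - α * δ) * g.dist y y')) * (g.L ^ |γ| * g.len y' ^ γ) := mul_le_mul_of_nonneg_left h1 hE
    _ = C * g.L ^ |γ| * Real.exp (-((r - α * δ) * g.dist y y')) * g.len y' ^ γ := by ring

/-- **A LENGTH-WEIGHTED SOURCE, AN UNWEIGHTED TARGET**: a majorant `C·e^{−rd}` from `b₁` to `b₂` is the majorant `C·L·(Lʲη)(a)·e^{−(r−αδ)d}` from the source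
re-weighted by `(Lʲη)⁻¹` to `b₂` (the length of the input class traded for the length of the output class by [4] (2.60)). [cite: Balaban1985BackgroundPropagators, p.398 (remark after (3.47)); Balaban1984PropagatorsII, Lemma 2.1 (2.60) p.234] -/
theorem hasMaj_weight_source_inv_len (hG : GeoOK g) {dF : ℕ} {δ α L₀ : ℝ} (hF : Facts347 g R₀ H₀ dF δ α L₀)
    {b₁ : BlockNorm (toB6 g R₀ H₀) F₁} {b₂ : BlockNorm (toB6 g R₀ H₀) F₂} {T : F₁ →ₗ[ℝ] F₂} {C r : ℝ} (hC : 0 ≤ C)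
    (h : HasMaj b₁ b₂ T (fun a a' => C * Real.exp (-(r * g.dist a a')))) :
    HasMaj (weightNorm b₁ (fun y => (g.len y)⁻¹) fun y => inv_nonneg.2 (hG.lenle y)) b₂ T
      (fun a a' => C * g.L * g.len a * Real.exp (-((r - α * δ) * g.dist a a'))) := by
  intro y' μ hμ y
  change g.Site at y'
  change g.Site at y
  have hb := h y' μ hμ y
  rw [B9SectDSup.weightNorm_loc]
  have h1 : Real.exp (-(α * δ * g.dist y y')) * g.len y' ≤ g.L * g.len y := by
    have := scaleTransfer_len_rpow hF 1 (by norm_num) y y'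
    simpa only [abs_one, Real.rpow_one] using this
  have hl' : 0 < g.len y' := hG.lenpos y'
  have hN : 0 ≤ b₁.loc y' μ := b₁.loc_nonneg y' μ
  have hsplit : Real.exp (-(r * g.dist y y')) = Real.exp (-((r - α * δ) * g.dist y y')) * Real.exp (-(α * δ * g.dist y y')) := by
    rw [← Real.exp_add]; congr 1; ring
  have hE : 0 ≤ C * Real.exp (-((r - α * δ) * g.dist y y')) := mul_nonneg hC (Real.exp_nonneg _)
  calc b₂.loc y (T μ) ≤ C * Real.exp (-(r * g.dist y y')) * b₁.loc y' μ := hb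
    _ = C * Real.exp (-((r - α * δ) * g.dist y y')) * (Real.exp (-(α * δ * g.dist y y')) * g.len y') * ((g.len y')⁻¹ * b₁.loc y' μ) := by
        rw [hsplit]; field_simp
    _ ≤ C * Real.exp (-((r - α * δ) * g.dist y y')) * (g.L * g.len y) * ((g.len y')⁻¹ * b₁.loc y' μ) :=
        mul_le_mul_of_nonneg_right (mul_le_mul_of_nonneg_left h1 hE) (mul_nonneg (inv_nonneg.2 hl'.le) hN)
    _ = C * g.L * g.len y * Real.exp (-((r - α * δ) * g.dist y y')) * ((g.len y')⁻¹ * b₁.loc y' μ) := by ring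

end Weight

end Literature.MathematicalPhysics.QuantumFieldTheory.Balaban1983to89.B9GradViaDivLettersAtPinsHolderPairs

end
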